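import Literature.MathematicalPhysics.QuantumFieldTheory.Balaban1983to89.Node00.HistoryTermDatum214OlderReading
import Literature.MathematicalPhysics.QuantumFieldTheory.Balaban1983to89.Node00.HistoryTermDatum214LocalGrowthAnalytic

/-!
# NODE 00 (YM-PLAN Track A) — W1 = [II] §2 (2.13)–(2.14), STOREY 17c: THE (1.33)∕(1.41) READING OF THE HISTORY BY THE OLDER-TERMS
# POTENTIAL IN THE COMPLEXIFIED UNSCALED FIELD (`W1.TermDatum214.ReadingAtomsC`, `ReadingAtomsC.potentialC`, `ReadingAtomsC.toReal`,
# `W1.TermDatum214.readOlderC`, the laws `MapsToTablesC ∕ CfgFieldHoloOn ∕ CfgCHoloOn ∕ CfgCContinuous ∕ CfgCJointContinuous ∕ FiniteMassAt ∕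
# LocalInC`, the letter `crudeBound`, the schema `ReadsOnByC`)

NODE 00 DEFINER MODULE (seat `pub-ymgap-node00-def-W1`, generation 26, 2026-08-27).  APPEND-ONLY: a NEW importing module; g22's
`Node00/HistoryTermDatum214OlderReading` (storey 17: `ReadingAtoms`, `ReadingAtoms.potential`, the laws `MapsToTables ∕ CfgHoloOn ∕ CfgContinuous ∕
CfgJointContinuous ∕ KernelBounded ∕ FiniteMass ∕ LocalIn`, `readOlder`, `ReadsBy ∕ ReadsOnBy`), g15's `Node00/HistoryTermDatum214LocalGrowthAnalytic`
(storey 12b: `ComplexOlder`, `realSliceOlder`) and dag-n10-c's `B13Lemma2LeadingParts` (module 48: `ofRealVec`, `continuous_ofRealVec`) untouched and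
CONSUMED BY NAME.  Typed on the pub-ymgap bus for the by-name ask «W1-17c» of seat `pub-ymgap-dag-n22-c` g10 (2026-08-27 22:24Z; record
`SliceInputsL2U` p578863, whose older-terms half of Lemma 2's sentence — `Oc : 𝔇.ComplexOlder`, `h𝒪re`, `hOd`, `hOM` with the letter `M𝒪` — asks a
COMPLEX-FIELD extension of `𝒪(old, ξ; Y, ·)`, complex-differentiable and sup-bounded on the ball `‖A‖ < R_A` of the complexified unscaled field,
uniformly on the window `W` and on the admissible class; «dischargeable from a READING exactly as J15 discharged the qualitative laws — IF the
reading atoms accept complex fields: W1-17 `ReadingAtoms.cfg` is real-field only»).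

## What this storey types, and why

Storey 17 reads the older-terms potential, slice by slice, as `𝒪_R(old, ξ; Y, A) = Σ_{j ≤ k} Σ_{X ∈ 𝐃_j} ∫ K_{Y,j,X}(s)·E^{(j)}(X; cfg_{Y,j,X}(ξ, A, s)) dμ`
at REAL unscaled row-bond fields `A : Λ → ℝ`.  Print's potentials are functions of a COMPLEX field: [I] p. 272 ll. 8–11 — `E^{(j)}(X, exp(iξA)U_{k+1})`
«is obtained from the analytic function E^{(j)}(X, U′, J′) by the substitution `U′ = exp(iξA)U_{k+1}, J′ = …` (3.10)»; ll. 33–39 — (3.13) «is an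
analytic function on this space, and also an analytic function of A, for A, ∂*A, Δ*A sufficiently small … the function (3.13) is analytic in A, for
A satisfying the conditions |A|, |∂*A|, …, < α₂ on X (3.14)»; [II] Lemma 1 p. 9 ll. 32–34 — `𝐕′_k(Y, U, J, B)` «defined and analytic on the space
𝔘ᶜ_{k+1}(Y,(1+β)α₀,(1+β)α₁,ε₀) × {B : |B| < ε₁g_k⁻¹ on Y} (1.34)»; p. 10 ll. 30–31 — «an analytic function of (U, J) in the space …, and of B′ in
the domain {B′ : e^{16κ₁}|B′| ≤ a₁ on Y}»; Lemma 2 p. 11 ll. 17–18 — `𝐕_k(Y,U,J,B)` «defined and analytic on the space (1.34)», its older-terms part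
`𝐕″_k` bounded by (1.36).  So the configuration families of the reading accept complex fields `z : Λ → ℂ` and move ANALYTICALLY with `z` on a
sup-ball, and the read potential is then analytic in `z` there — the dominated holomorphic parametric integral once more, the parameter now being
the complex field.  This storey types exactly that: `ReadingAtomsC` = (measures, kernels, configuration families `cfgC_{Y,j,X}(ξ, z, s)` on COMPLEX
fields); its REAL SLICE `ReadingAtomsC.toReal : ReadingAtoms` (`cfg(ξ, A, s) := cfgC(ξ, A ↪ ℂ, s)` — so EVERY law and face of storey 17 applies to the
real slice BY NAME); the complex read potential `potentialC` with `toReal.potential(old, ξ; Y, A) = potentialC(old, ξ; Y, A ↪ ℂ)` (`rfl` — the record's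
`h𝒪re` for a read pair); the complex-side LAWS as displayed `Prop`s (`MapsToTablesC`: the configurations moved by complex fields of the field set `𝔅c`
stay in the tables; `CfgFieldHoloOn`: analytic in the field on `𝔅c`; `CfgCHoloOn`: analytic in the configuration at complex fields; `CfgCContinuous` ∕
`CfgCJointContinuous`; `KernelBounded` ∕ `FiniteMass` = storey 17's cfg-free laws by name; `FiniteMassAt`: PER-ATOM masses `m Y j X`, for the located
size letter; `LocalInC`); the honesty instance `ReadingAtomsC.zero`; the algebraic faces (history seen only on the tables, `ℂ`-homogeneity, field
locality); the size letter `crudeBound C E₀ r₁ m Y = Σ_j Σ_X C·E₀e^{−r₁d_j(X)}·m(Y,j,X)` with its sign (the record's `hM𝒪` shape) and the crude ∕ located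
(1.18)-size faces `norm_potentialC_le_of_sizeAdm[_at]` (the record's `hOM` shape with `M𝒪 := crudeBound …`); the analytic faces
`differentiableOn_potentialC_field_of_admHist` (the record's `hOd` shape: `z ↦ potentialC(old, ξ; Y, z)` complex-differentiable on an open `𝔅c`, every
admissible history, every `ξ ∈ W`) and `differentiableOn_potentialC_config_of_admHist` (in `ξ` at a complex field); the datum-level reading
`readOlderC Rc : 𝔇.ComplexOlder` with `realSliceOlder (readOlderC Rc) = readOlder (toReal ∘ Rc)` (`rfl`); the hypothesis schema `ReadsOnByC` on an
OPAQUE `Oc : 𝔇.ComplexOlder` (located: admissible histories × window × complex field set) with `ReadsOnByC.realSlice` (⇒ storey 17's `ReadsOnBy` for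
`realSliceOlder Oc` on the real slice, hence module J15's four laws by name) and the transfer faces `ReadsOnByC.differentiableOn_field ∕ norm_le ∕
norm_le_at ∕ differentiableOn_config` (the record's `hOd` ∕ `hOM` VERBATIM at `𝔅c := ball 0 R_A`, binder for binder).

The complex field set `𝔅c : Set (Λ → ℂ)` of the laws is a binder (the consumer instantiates the open sup-ball `ball 0 R_A`, [I] (3.14) ∕ [II] (1.34));
analyticity in the field is asked ON `𝔅c` ONLY.  A producer who must also meet the ALL-REAL-FIELD quantifiers of the N22 records on the real slice
(storey 17's clamping remark) composes the moved configuration with a continuous retraction of `Λ → ℂ` onto a closed ball that is the identity on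
`ball 0 R_A`: analytic on the open ball, continuous everywhere, in the tables for every field — the laws here are split accordingly (`CfgFieldHoloOn W 𝔅c`
on the ball; `MapsToTablesC` ∕ continuity on whatever field set the consumer names).

HONEST LIMITS.  Hypothesis-schema style: an OBJECT and its laws, NOTHING asserted of print's data; the PRODUCER (NODE A at the record) still owes a
complex reading `Rc` WITH the laws at the datum of record — N22 is NOT discharged here; no estimate of print ((1.36), (1.42)–(1.43), [I] (3.9), (3.14))
is claimed or re-proved — in particular the decay of (1.36) in `d_k(Y)` is whatever the producer's per-atom masses carry, not a theorem of this file;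
the quadratic-form part of (1.42) is the Wilson side, not read here.

## CITATION HEADER (D-0065)
- [II] = T. Bałaban, Renormalization group approach to lattice gauge field theories. II. Cluster expansions, Comm. Math. Phys. 116 (1988) 1–22
  [Balaban1988RG2Cluster]: Lemma 1 (1.33)–(1.36) p. 9 ll. 28–38 (quoted above: ll. 32–34); p. 10 ll. 30–31; Lemma 2 (1.41)–(1.43) p. 11 ll. 14–26;
  (1.10) p. 4, (1.23) p. 7 (the parameter integrals); (2.2)–(2.3) p. 12 (box-support coordinates); (2.14) p. 15 ll. 19–20.
- [I] = T. Bałaban, Renormalization group approach to lattice gauge field theories. I, Comm. Math. Phys. 109 (1987) 249–301 [Balaban1987RG1]: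
  §1 p. 263 (analyticity of `E^{(j)}` on `U^c_j`, (1.18)); (3.4) p. 270; (3.10) and (3.13)–(3.14) p. 272 ll. 8–11, 33–39; (3.15)–(3.18) p. 273.
- Pages were read from the materialised texts `paper:balaban1988-cmp116-rg-ii-cluster` pp. 9–11 and `paper:balaban1987-cmp109-rg-i-small-field`
  pp. 272–273 (journal pagination; PDF pp. 24–25 of [I]).

Typer lint: no `instance`, no `notation`, no attribute removal, no `sorry`; one file for one source section (the complex-field reading behind
(1.33)∕(1.34)∕(1.41)).
-/

open scoped BigOperators

noncomputable section

namespace Literature.MathematicalPhysics.QuantumFieldTheory.Balaban1983to89.Node00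

open Metric Set Filter
open _root_.MeasureTheory
open Literature.MathematicalPhysics.QuantumFieldTheory.Balaban1983to89
open TreeLengthTorus Sect2
open Literature.MathematicalPhysics.QuantumFieldTheory.Balaban1983to89.B13Lemma2LeadingParts (ofRealVec ofRealVec_apply continuous_ofRealVec)

namespace W1

namespace TermDatum214

variable {c : B13.Consts} {P : Params} {𝔸 : Type*} {M k L : ℕ} [NeZero L] (𝔇 : TermDatum214 c P 𝔸 M k L)

/-! ## §0  Per-atom masses and the located size letter (cfg-free; stated for storey 17's real atoms too) -/

/-- **THE LOCATED CRUDE SIZE LETTER `M(Y) = Σ_{j ≤ k} Σ_{X ∈ 𝐃_j} C·E₀e^{−r₁d_j(X)}·m(Y, j, X)`** of a reading with kernel bound `C`, per-atom masses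
`m Y j X` and an `(E₀, r₁)`-size-admissible history ([I] (1.18) p. 263 on each table, times kernel bound and mass, summed over the atoms of `Y`).
HONEST: the decay of print's (1.36) in `d_k(Y)` is carried (or not) by the producer's masses `m Y j X` (zero for the atoms that do not contribute to
`Y`); nothing of it is claimed here. [cite: Balaban1987RG1, (1.18) p.263; Balaban1988RG2Cluster, (1.36) p.9 (the shape of the letter only)] -/
def crudeBound (C E₀ r₁ : ℝ) (m : TDom P.d (L * domCount P M (k + 1)) → (j : Fin (k + 1)) → (domSys P M j).Dom → ℝ)
    (Y : TDom P.d (L * domCount P M (k + 1))) : ℝ :=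
  ∑ j : Fin (k + 1), ∑ X : (domSys P M j).Dom, C * (E₀ * Real.exp (-(r₁ * (domSys P M j).dj X))) * m Y j X

/-- The letter unfolded (`rfl`). [cite: Balaban1988RG2Cluster, (1.36) p.9 (bookkeeping)] -/
theorem crudeBound_eq (C E₀ r₁ : ℝ) (m : TDom P.d (L * domCount P M (k + 1)) → (j : Fin (k + 1)) → (domSys P M j).Dom → ℝ)
    (Y : TDom P.d (L * domCount P M (k + 1))) :
    crudeBound C E₀ r₁ m Y = ∑ j : Fin (k + 1), ∑ X : (domSys P M j).Dom, C * (E₀ * Real.exp (-(r₁ * (domSys P M j).dj X))) * m Y j X :=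
  rfl

/-- **Face: the located size letter is nonnegative** for nonnegative kernel bound, size and masses (the record's `hM𝒪` shape).
[cite: Balaban1988RG2Cluster, (1.36) p.9 (bookkeeping)] -/
theorem crudeBound_nonneg {C E₀ r₁ : ℝ} {m : TDom P.d (L * domCount P M (k + 1)) → (j : Fin (k + 1)) → (domSys P M j).Dom → ℝ}
    (hC : 0 ≤ C) (hE₀ : 0 ≤ E₀) (hm : ∀ Y j X, 0 ≤ m Y j X) (Y : TDom P.d (L * domCount P M (k + 1))) : 0 ≤ crudeBound C E₀ r₁ m Y :=
  Finset.sum_nonneg fun j _ => Finset.sum_nonneg fun X _ =>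
    mul_nonneg (mul_nonneg hC (mul_nonneg hE₀ (Real.exp_pos _).le)) (hm Y j X)

/-- At constant masses the located letter is storey 17's `Y`-free crude constant (`rfl`). [cite: Balaban1988RG2Cluster, (1.36) p.9 (bookkeeping)] -/
theorem crudeBound_const (C E₀ r₁ m : ℝ) (Y : TDom P.d (L * domCount P M (k + 1))) :
    crudeBound C E₀ r₁ (fun (_ : TDom P.d (L * domCount P M (k + 1))) (j : Fin (k + 1)) (_ : (domSys P M j).Dom) => m) Y =
      ∑ j : Fin (k + 1), ∑ X : (domSys P M j).Dom, C * (E₀ * Real.exp (-(r₁ * (domSys P M j).dj X))) * m :=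
  rfl

namespace ReadingAtoms

variable {𝔇}
variable {Z : (domSys P M (k + 1)).Dom} {t : TermLabel P M k L} {S : Type*} [MeasurableSpace S] (R : 𝔇.ReadingAtoms Z t S)

/-- **LAW (storey 17's atoms): the measures are finite with PER-ATOM total masses at most `m Y j X`** (zero for the atoms `(j, X)` that do not
contribute to `Y`; the located form of `FiniteMass`). [cite: Balaban1987RG1, (3.4) p.270 and (3.15) p.273; Balaban1988RG2Cluster, (1.10) p.4, (1.23) p.7 and (1.36) p.9] -/
def FiniteMassAt (m : TDom P.d (L * domCount P M (k + 1)) → (j : Fin (k + 1)) → (domSys P M j).Dom → ℝ) : Prop :=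
  ∀ (Y : TDom P.d (L * domCount P M (k + 1))) (j : Fin (k + 1)) (X : (domSys P M j).Dom),
    IsFiniteMeasure (R.μ Y j X) ∧ (R.μ Y j X).real univ ≤ m Y j X

/-- Face: a uniform mass bound is a per-atom mass bound at constant masses. [cite: Balaban1988RG2Cluster, (1.36) p.9 (bookkeeping)] -/
theorem FiniteMass.finiteMassAt {R : 𝔇.ReadingAtoms Z t S} {m : ℝ} (h : R.FiniteMass m) :
    R.FiniteMassAt fun (_ : TDom P.d (L * domCount P M (k + 1))) (j : Fin (k + 1)) (_ : (domSys P M j).Dom) => m :=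
  h

/-- **Face (storey 17's atoms): the LOCATED crude (1.18)-size of the reading of a size-admissible history** — with per-atom masses, `‖𝒪_R(old, ξ;
Y, A)‖ ≤ crudeBound C E₀ r₁ m Y`. [cite: Balaban1987RG1, (1.18) p.263; Balaban1988RG2Cluster, (1.36) p.9 (the crude located form only)] -/
theorem norm_potential_le_of_sizeAdm_at {sp : (j : ℕ) → (domSys P M j).Dom → Set (CPair P 𝔸)} {W : Set (CPair P 𝔸)}
    {𝔅 : Set ((𝔇.𝒦 Z t).Λ → ℝ)} {C E₀ r₁ : ℝ} {m : TDom P.d (L * domCount P M (k + 1)) → (j : Fin (k + 1)) → (domSys P M j).Dom → ℝ}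
    (hC : 0 ≤ C) (hE₀ : 0 ≤ E₀) (hmaps : R.MapsToTables sp W 𝔅) (hK : R.KernelBounded C) (hμ : R.FiniteMassAt m) {old : OlderTerms P 𝔸 M k}
    (hold : old ∈ SizeAdm sp E₀ r₁ k) {ξ : CPair P 𝔸} (hξ : ξ ∈ W) (Y : TDom P.d (L * domCount P M (k + 1))) {A : (𝔇.𝒦 Z t).Λ → ℝ} (hA : A ∈ 𝔅) :
    ‖R.potential old ξ Y A‖ ≤ crudeBound C E₀ r₁ m Y := by
  refine (norm_sum_le _ _).trans (Finset.sum_le_sum fun j _ => (norm_sum_le _ _).trans (Finset.sum_le_sum fun X _ => ?_))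
  obtain ⟨-, hKb⟩ := hK Y j X
  obtain ⟨hfin, hmass⟩ := hμ Y j X
  haveI := hfin
  have hc : 0 ≤ C * (E₀ * Real.exp (-(r₁ * (domSys P M j).dj X))) := mul_nonneg hC (mul_nonneg hE₀ (Real.exp_pos _).le)
  have hpt : ∀ s, ‖R.K Y j X s * old j X (R.cfg Y j X ξ A s)‖ ≤ C * (E₀ * Real.exp (-(r₁ * (domSys P M j).dj X))) := fun s => by
    rw [norm_mul]
    exact mul_le_mul (hKb s) (hold j X _ (hmaps Y j X ξ hξ A hA s)) (norm_nonneg _) hC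
  calc ‖∫ s, R.K Y j X s * old j X (R.cfg Y j X ξ A s) ∂(R.μ Y j X)‖
      ≤ C * (E₀ * Real.exp (-(r₁ * (domSys P M j).dj X))) * (R.μ Y j X).real univ :=
        norm_integral_le_of_norm_le_const (Eventually.of_forall hpt)
    _ ≤ C * (E₀ * Real.exp (-(r₁ * (domSys P M j).dj X))) * m Y j X := mul_le_mul_of_nonneg_left hmass hc

end ReadingAtoms

/-! ## §1  The atoms of a reading of the older terms IN THE COMPLEXIFIED FIELD, their real slice, and the complex read potential -/

/-- **THE ATOMS OF A READING OF THE OLDER TERMS AT THE TERM SLICE `(Z, t)` IN THE COMPLEXIFIED UNSCALED FIELD** over a parameter space `S`: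
per localization domain `Y`, level `j ≤ k` and domain `X ∈ 𝐃_j` — a MEASURE `μ Y j X` on `S`, a KERNEL `K Y j X : S → ℂ`, and a CONFIGURATION
FAMILY `cfgC Y j X : ξ ↦ z ↦ s ↦` the configuration at which `E^{(j)}(X; ·)` is evaluated, the unscaled row-bond field `z : Λ → ℂ` now COMPLEX
([I] (3.10) p. 272 `U′ = exp(iξA)U_{k+1}` with (3.13)–(3.14): «analytic in A, for A satisfying … < α₂ on X»; [II] (1.34) p. 9: «analytic on … ×
{B : |B| < ε₁g_k⁻¹ on Y}»).  Pure data; the laws are the displayed `Prop`s of §2; the real slice is storey 17's `ReadingAtoms` (`toReal`).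
[cite: Balaban1987RG1, (3.10) and (3.13)-(3.14) p.272, (3.4) p.270 and (3.15)-(3.18) p.273; Balaban1988RG2Cluster, Lemma 1 (1.33)-(1.35) p.9, p.10 ll.30-31 and Lemma 2 (1.41)-(1.42) p.11] -/
structure ReadingAtomsC (Z : (domSys P M (k + 1)).Dom) (t : TermLabel P M k L) (S : Type*) [MeasurableSpace S] where
  /-- the integration measure of the atom `(Y, j, X)` -/
  μ : TDom P.d (L * domCount P M (k + 1)) → (j : Fin (k + 1)) → (domSys P M j).Dom → Measure S
  /-- the kernel of the atom `(Y, j, X)` -/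
  K : TDom P.d (L * domCount P M (k + 1)) → (j : Fin (k + 1)) → (domSys P M j).Dom → S → ℂ
  /-- the configuration family of the atom `(Y, j, X)` on COMPLEX fields: reference configuration `ξ`, complexified unscaled row-bond field `z`,
  parameter `s` ↦ the moved configuration -/
  cfgC : TDom P.d (L * domCount P M (k + 1)) → (j : Fin (k + 1)) → (domSys P M j).Dom → CPair P 𝔸 → ((𝔇.𝒦 Z t).Λ → ℂ) → S → CPair P 𝔸

namespace ReadingAtomsC

variable {𝔇}
variable {Z : (domSys P M (k + 1)).Dom} {t : TermLabel P M k L} {S : Type*} [MeasurableSpace S] (R : 𝔇.ReadingAtomsC Z t S)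

/-- **THE REAL SLICE OF A COMPLEX READING**: the same measures and kernels, the configuration family read at real fields `A ↪ ℂ` (module 48's
`ofRealVec`) — a storey-17 `ReadingAtoms`, so that every law and face of storey 17 applies to it by name.
[cite: Balaban1988RG2Cluster, Lemma 1 (1.33)-(1.34) p.9 (bookkeeping); Balaban1987RG1, (3.10) p.272] -/
def toReal : 𝔇.ReadingAtoms Z t S :=
  ⟨R.μ, R.K, fun Y j X ξ A s => R.cfgC Y j X ξ (ofRealVec A) s⟩

/-- The real slice's measures (`rfl`). [cite: Balaban1988RG2Cluster, Lemma 1 (1.33) p.9 (bookkeeping)] -/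
@[simp] theorem toReal_μ : R.toReal.μ = R.μ := rfl

/-- The real slice's kernels (`rfl`). [cite: Balaban1988RG2Cluster, Lemma 1 (1.33) p.9 (bookkeeping)] -/
@[simp] theorem toReal_K : R.toReal.K = R.K := rfl

/-- **The real face**: the real slice's configuration family is the complex one at `A ↪ ℂ` (`rfl`).
[cite: Balaban1987RG1, (3.10) p.272; Balaban1988RG2Cluster, (1.34) p.9 (bookkeeping)] -/
@[simp] theorem toReal_cfg (Y : TDom P.d (L * domCount P M (k + 1))) (j : Fin (k + 1)) (X : (domSys P M j).Dom) (ξ : CPair P 𝔸)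
    (A : (𝔇.𝒦 Z t).Λ → ℝ) (s : S) : R.toReal.cfg Y j X ξ A s = R.cfgC Y j X ξ (ofRealVec A) s := rfl

/-- **THE COMPLEX READ OLDER-TERMS POTENTIAL `𝒪ᶜ_R(old, ξ; Y, z)`**: the sum over levels `j ≤ k` and domains `X ∈ 𝐃_j` of the integrals
`∫ K_{Y,j,X}(s) · E^{(j)}(X; cfgC_{Y,j,X}(ξ, z, s)) dμ_{Y,j,X}(s)` at a COMPLEX unscaled field `z` — Lemma 1's `𝐕′_k(Y, U, J, B)` ∕ Lemma 2's `𝐕″_k` on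
the space (1.34).  (Bochner integral; junk `0` on a non-integrable atom — the laws of §2 make every atom of an admissible history integrable.)
[cite: Balaban1988RG2Cluster, Lemma 1 (1.33)-(1.34) p.9 and Lemma 2 (1.41)-(1.42) p.11; Balaban1987RG1, (3.4) p.270, (3.10) and (3.13) p.272, (3.15) p.273] -/
def potentialC (old : OlderTerms P 𝔸 M k) (ξ : CPair P 𝔸) (Y : TDom P.d (L * domCount P M (k + 1))) (z : (𝔇.𝒦 Z t).Λ → ℂ) : ℂ :=
  ∑ j : Fin (k + 1), ∑ X : (domSys P M j).Dom, ∫ s, R.K Y j X s * old j X (R.cfgC Y j X ξ z s) ∂(R.μ Y j X)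

/-- The complex read potential unfolded (`rfl`). [cite: Balaban1988RG2Cluster, Lemma 1 (1.33) p.9 (bookkeeping)] -/
theorem potentialC_eq (old : OlderTerms P 𝔸 M k) (ξ : CPair P 𝔸) (Y : TDom P.d (L * domCount P M (k + 1))) (z : (𝔇.𝒦 Z t).Λ → ℂ) :
    R.potentialC old ξ Y z = ∑ j : Fin (k + 1), ∑ X : (domSys P M j).Dom, ∫ s, R.K Y j X s * old j X (R.cfgC Y j X ξ z s) ∂(R.μ Y j X) :=
  rfl

/-- **★ THE REAL-SLICE IDENTITY** (the record's `h𝒪re` for a read pair): storey 17's read potential of the real slice IS the complex read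
potential at `A ↪ ℂ` (`rfl`). [cite: Balaban1988RG2Cluster, Lemma 1 (1.33)-(1.35) p.9 and Lemma 2 (1.41) p.11; Balaban1987RG1, (3.10) p.272] -/
theorem toReal_potential (old : OlderTerms P 𝔸 M k) (ξ : CPair P 𝔸) (Y : TDom P.d (L * domCount P M (k + 1))) (A : (𝔇.𝒦 Z t).Λ → ℝ) :
    R.toReal.potential old ξ Y A = R.potentialC old ξ Y (ofRealVec A) :=
  rfl

/-! ## §2  The laws of a complex reading (displayed `Prop`s, nothing asserted) -/

/-- **LAW: the configurations moved by COMPLEX fields stay in the tables.**  For reference configurations `ξ` in the window `W` and complex fields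
`z` in the field set `𝔅c` (the open sup-ball of [I] (3.14) ∕ [II] (1.34), or a larger set for a producer clamping outside it), every configuration
`cfgC_{Y,j,X}(ξ, z, s)` lies in the table `sp j X` on which `E^{(j)}(X; ·)` is bounded and analytic ([I] (3.17)–(3.18) p. 273; §1 p. 263).
[cite: Balaban1987RG1, (3.13)-(3.14) p.272, (3.17)-(3.18) p.273 and §1 p.263; Balaban1988RG2Cluster, (1.34)-(1.35) p.9] -/
def MapsToTablesC (sp : (j : ℕ) → (domSys P M j).Dom → Set (CPair P 𝔸)) (W : Set (CPair P 𝔸)) (𝔅c : Set ((𝔇.𝒦 Z t).Λ → ℂ)) : Prop :=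
  ∀ (Y : TDom P.d (L * domCount P M (k + 1))) (j : Fin (k + 1)) (X : (domSys P M j).Dom), ∀ ξ ∈ W, ∀ z ∈ 𝔅c, ∀ s : S,
    R.cfgC Y j X ξ z s ∈ sp j X

/-- **LAW: the configuration families are ANALYTIC IN THE COMPLEX FIELD on the field set `𝔅c`**, for every `ξ ∈ W` and parameter ([I] p. 272
ll. 33–39: (3.13) «analytic in A, for A satisfying the conditions (3.14)»; the field enters through `exp(iξA)`, (3.10); [II] (1.34) p. 9).
[cite: Balaban1987RG1, (3.10) and (3.13)-(3.14) p.272; Balaban1988RG2Cluster, (1.34) p.9 and p.10 ll.30-31] -/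
def CfgFieldHoloOn [NormedRing 𝔸] [NormedAlgebra ℂ 𝔸] (W : Set (CPair P 𝔸)) (𝔅c : Set ((𝔇.𝒦 Z t).Λ → ℂ)) : Prop :=
  ∀ (Y : TDom P.d (L * domCount P M (k + 1))) (j : Fin (k + 1)) (X : (domSys P M j).Dom), ∀ ξ ∈ W, ∀ s : S,
    DifferentiableOn ℂ (fun z : (𝔇.𝒦 Z t).Λ → ℂ => R.cfgC Y j X ξ z s) 𝔅c

/-- **LAW: the configuration families move analytically with the reference configuration** on the window `W`, at every complex field of `𝔅c`
([I] p. 272 ll. 8–11: «obtained from the analytic function E^{(j)}(X, U′, J′) by the substitution (3.10)»; [II] p. 15 ll. 19–20).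
[cite: Balaban1987RG1, (3.10) p.272; Balaban1988RG2Cluster, (2.14) p.15] -/
def CfgCHoloOn [NormedRing 𝔸] [NormedAlgebra ℂ 𝔸] (W : Set (CPair P 𝔸)) (𝔅c : Set ((𝔇.𝒦 Z t).Λ → ℂ)) : Prop :=
  ∀ (Y : TDom P.d (L * domCount P M (k + 1))) (j : Fin (k + 1)) (X : (domSys P M j).Dom), ∀ z ∈ 𝔅c, ∀ s : S,
    DifferentiableOn ℂ (fun ξ : CPair P 𝔸 => R.cfgC Y j X ξ z s) W

/-- **LAW: the configuration families depend continuously on the parameters** at every complex field (the interpolation ∕ contour variables of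
(3.4), (3.15), (1.10), (1.23)). [cite: Balaban1987RG1, (3.4) p.270 and (3.15) p.273; Balaban1988RG2Cluster, (1.23) p.7] -/
def CfgCContinuous [TopologicalSpace S] [TopologicalSpace 𝔸] : Prop :=
  ∀ (Y : TDom P.d (L * domCount P M (k + 1))) (j : Fin (k + 1)) (X : (domSys P M j).Dom) (ξ : CPair P 𝔸) (z : (𝔇.𝒦 Z t).Λ → ℂ),
    Continuous fun s : S => R.cfgC Y j X ξ z s

/-- **LAW: the configuration families depend continuously on the complex field and the parameters jointly** (the field enters through
`exp(iξA)`, [I] (3.10)); implies `CfgCContinuous` and the real slice's `CfgJointContinuous`. [cite: Balaban1987RG1, (3.10) p.272] -/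
def CfgCJointContinuous [TopologicalSpace S] [TopologicalSpace 𝔸] : Prop :=
  ∀ (Y : TDom P.d (L * domCount P M (k + 1))) (j : Fin (k + 1)) (X : (domSys P M j).Dom) (ξ : CPair P 𝔸),
    Continuous fun p : ((𝔇.𝒦 Z t).Λ → ℂ) × S => R.cfgC Y j X ξ p.1 p.2

/-- **LAW: the kernels are measurable and bounded by `C`** — storey 17's cfg-free law on the real slice, by name.
[cite: Balaban1987RG1, (3.15) p.273; Balaban1988RG2Cluster, (1.22)-(1.23) p.7] -/
def KernelBounded (C : ℝ) : Prop :=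
  R.toReal.KernelBounded C

/-- **LAW: the measures are finite with total mass at most `m`** — storey 17's cfg-free law on the real slice, by name.
[cite: Balaban1987RG1, (3.4) p.270 and (3.15) p.273; Balaban1988RG2Cluster, (1.10) p.4 and (1.23) p.7] -/
def FiniteMass (m : ℝ) : Prop :=
  R.toReal.FiniteMass m

/-- **LAW: the measures are finite with PER-ATOM masses at most `m Y j X`** — §0's located law on the real slice, by name.
[cite: Balaban1988RG2Cluster, (1.10) p.4, (1.23) p.7 and (1.36) p.9] -/
def FiniteMassAt (m : TDom P.d (L * domCount P M (k + 1)) → (j : Fin (k + 1)) → (domSys P M j).Dom → ℝ) : Prop :=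
  R.toReal.FiniteMassAt m

/-- **LAW: the configuration families of the domains `Y ∈ 𝐃 = t.1` read the COMPLEX field only in the coordinate set `S₀`** (the box-support
coordinates of [II] (2.2)–(2.3)). [cite: Balaban1988RG2Cluster, (2.2)-(2.3) p.12 and (1.34) p.9] -/
def LocalInC (S₀ : Set (𝔇.𝒦 Z t).Λ) : Prop :=
  ∀ Y ∈ t.1, ∀ (j : Fin (k + 1)) (X : (domSys P M j).Dom) (ξ : CPair P 𝔸) (z z' : (𝔇.𝒦 Z t).Λ → ℂ), (∀ b ∈ S₀, z b = z' b) →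
    ∀ s : S, R.cfgC Y j X ξ z s = R.cfgC Y j X ξ z' s

/-- Face: `KernelBounded` unfolded (`Iff.rfl`). [cite: Balaban1988RG2Cluster, (1.23) p.7 (bookkeeping)] -/
theorem kernelBounded_iff {C : ℝ} :
    R.KernelBounded C ↔ ∀ (Y : TDom P.d (L * domCount P M (k + 1))) (j : Fin (k + 1)) (X : (domSys P M j).Dom),
      Measurable (R.K Y j X) ∧ ∀ s : S, ‖R.K Y j X s‖ ≤ C :=
  Iff.rfl

/-- Face: `FiniteMass` unfolded (`Iff.rfl`). [cite: Balaban1988RG2Cluster, (1.23) p.7 (bookkeeping)] -/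
theorem finiteMass_iff {m : ℝ} :
    R.FiniteMass m ↔ ∀ (Y : TDom P.d (L * domCount P M (k + 1))) (j : Fin (k + 1)) (X : (domSys P M j).Dom),
      IsFiniteMeasure (R.μ Y j X) ∧ (R.μ Y j X).real univ ≤ m :=
  Iff.rfl

/-- Face: `FiniteMassAt` unfolded (`Iff.rfl`). [cite: Balaban1988RG2Cluster, (1.36) p.9 (bookkeeping)] -/
theorem finiteMassAt_iff {m : TDom P.d (L * domCount P M (k + 1)) → (j : Fin (k + 1)) → (domSys P M j).Dom → ℝ} :
    R.FiniteMassAt m ↔ ∀ (Y : TDom P.d (L * domCount P M (k + 1))) (j : Fin (k + 1)) (X : (domSys P M j).Dom),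
      IsFiniteMeasure (R.μ Y j X) ∧ (R.μ Y j X).real univ ≤ m Y j X :=
  Iff.rfl

/-- Face: a uniform mass bound is a per-atom mass bound at constant masses. [cite: Balaban1988RG2Cluster, (1.36) p.9 (bookkeeping)] -/
theorem FiniteMass.finiteMassAt {R : 𝔇.ReadingAtomsC Z t S} {m : ℝ} (h : R.FiniteMass m) :
    R.FiniteMassAt fun (_ : TDom P.d (L * domCount P M (k + 1))) (j : Fin (k + 1)) (_ : (domSys P M j).Dom) => m :=
  h

/-- Face: joint continuity in (field, parameter) gives continuity in the parameter. [cite: Balaban1987RG1, (3.10) p.272 (bookkeeping)] -/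
theorem CfgCJointContinuous.cfgCContinuous [TopologicalSpace S] [TopologicalSpace 𝔸] {R : 𝔇.ReadingAtomsC Z t S} (h : R.CfgCJointContinuous) :
    R.CfgCContinuous :=
  fun Y j X ξ z => (h Y j X ξ).comp (Continuous.prodMk_right z)

/-- Face: joint continuity in (complex field, parameter) gives the real slice's joint continuity in (real field, parameter) (`ofRealVec` is
continuous). [cite: Balaban1987RG1, (3.10) p.272 (bookkeeping)] -/
theorem CfgCJointContinuous.toReal [TopologicalSpace S] [TopologicalSpace 𝔸] {R : 𝔇.ReadingAtomsC Z t S} (h : R.CfgCJointContinuous) :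
    R.toReal.CfgJointContinuous :=
  fun Y j X ξ => (h Y j X ξ).comp ((continuous_ofRealVec.comp continuous_fst).prodMk continuous_snd)

/-- Face: continuity in the parameter at complex fields gives the real slice's continuity in the parameter.
[cite: Balaban1987RG1, (3.10) p.272 (bookkeeping)] -/
theorem CfgCContinuous.toReal [TopologicalSpace S] [TopologicalSpace 𝔸] {R : 𝔇.ReadingAtomsC Z t S} (h : R.CfgCContinuous) :
    R.toReal.CfgContinuous :=
  fun Y j X ξ A => h Y j X ξ (ofRealVec A)

/-- Face: a complex table law restricts to the real slice on any real field set whose complexification lies in `𝔅c`.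
[cite: Balaban1988RG2Cluster, (1.34) p.9 (bookkeeping)] -/
theorem MapsToTablesC.toReal {R : 𝔇.ReadingAtomsC Z t S} {sp : (j : ℕ) → (domSys P M j).Dom → Set (CPair P 𝔸)} {W : Set (CPair P 𝔸)}
    {𝔅c : Set ((𝔇.𝒦 Z t).Λ → ℂ)} {𝔅 : Set ((𝔇.𝒦 Z t).Λ → ℝ)} (h : R.MapsToTablesC sp W 𝔅c) (h𝔅 : ∀ A ∈ 𝔅, ofRealVec A ∈ 𝔅c) :
    R.toReal.MapsToTables sp W 𝔅 :=
  fun Y j X ξ hξ A hA s => h Y j X ξ hξ (ofRealVec A) (h𝔅 A hA) s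

/-- Face: configuration-analyticity at complex fields restricts to the real slice on any real field set whose complexification lies in `𝔅c`.
[cite: Balaban1987RG1, (3.10) p.272 (bookkeeping)] -/
theorem CfgCHoloOn.toReal [NormedRing 𝔸] [NormedAlgebra ℂ 𝔸] {R : 𝔇.ReadingAtomsC Z t S} {W : Set (CPair P 𝔸)} {𝔅c : Set ((𝔇.𝒦 Z t).Λ → ℂ)}
    {𝔅 : Set ((𝔇.𝒦 Z t).Λ → ℝ)} (h : R.CfgCHoloOn W 𝔅c) (h𝔅 : ∀ A ∈ 𝔅, ofRealVec A ∈ 𝔅c) : R.toReal.CfgHoloOn W 𝔅 :=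
  fun Y j X A hA s => h Y j X (ofRealVec A) (h𝔅 A hA) s

/-- Face: complex-field locality gives the real slice's field locality. [cite: Balaban1988RG2Cluster, (2.2)-(2.3) p.12 (bookkeeping)] -/
theorem LocalInC.toReal {R : 𝔇.ReadingAtomsC Z t S} {S₀ : Set (𝔇.𝒦 Z t).Λ} (h : R.LocalInC S₀) : R.toReal.LocalIn S₀ :=
  fun Y hY j X ξ A A' hAA' s => h Y hY j X ξ (ofRealVec A) (ofRealVec A') (fun b hb => by rw [ofRealVec_apply, ofRealVec_apply, hAA' b hb]) s

/-- Face: a law on larger classes restricts to smaller ones (`MapsToTablesC`). [cite: Balaban1988RG2Cluster, (1.34) p.9 (bookkeeping)] -/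
theorem MapsToTablesC.mono {R : 𝔇.ReadingAtomsC Z t S} {sp : (j : ℕ) → (domSys P M j).Dom → Set (CPair P 𝔸)} {W W' : Set (CPair P 𝔸)}
    {𝔅c 𝔅c' : Set ((𝔇.𝒦 Z t).Λ → ℂ)} (h : R.MapsToTablesC sp W 𝔅c) (hW : W' ⊆ W) (h𝔅 : 𝔅c' ⊆ 𝔅c) : R.MapsToTablesC sp W' 𝔅c' :=
  fun Y j X ξ hξ z hz s => h Y j X ξ (hW hξ) z (h𝔅 hz) s

/-- Face: field-analyticity on larger classes restricts to smaller ones (`CfgFieldHoloOn`). [cite: Balaban1987RG1, (3.14) p.272 (bookkeeping)] -/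
theorem CfgFieldHoloOn.mono [NormedRing 𝔸] [NormedAlgebra ℂ 𝔸] {R : 𝔇.ReadingAtomsC Z t S} {W W' : Set (CPair P 𝔸)}
    {𝔅c 𝔅c' : Set ((𝔇.𝒦 Z t).Λ → ℂ)} (h : R.CfgFieldHoloOn W 𝔅c) (hW : W' ⊆ W) (h𝔅 : 𝔅c' ⊆ 𝔅c) : R.CfgFieldHoloOn W' 𝔅c' :=
  fun Y j X ξ hξ s => (h Y j X ξ (hW hξ) s).mono h𝔅

/-! ## §3  Honesty instance: the zero complex reading -/

/-- **The zero complex reading**: all measures zero, kernels zero, configurations unmoved — the reading of a slice to which no older term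
contributes; its real slice is storey 17's zero reading. [cite: Balaban1988RG2Cluster, Lemma 1 (1.33) p.9 (degenerate instance)] -/
protected def zero : 𝔇.ReadingAtomsC Z t S :=
  ⟨fun _ _ _ => 0, fun _ _ _ _ => 0, fun _ _ _ ξ _ _ => ξ⟩

/-- Face: the zero complex reading reads every history as `0`. [cite: Balaban1988RG2Cluster, Lemma 1 (1.33) p.9 (degenerate instance)] -/
@[simp] theorem zero_potentialC (old : OlderTerms P 𝔸 M k) (ξ : CPair P 𝔸) (Y : TDom P.d (L * domCount P M (k + 1))) (z : (𝔇.𝒦 Z t).Λ → ℂ) :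
    (ReadingAtomsC.zero : 𝔇.ReadingAtomsC Z t S).potentialC old ξ Y z = 0 := by
  simp [potentialC, ReadingAtomsC.zero]

/-- Face: the real slice of the zero complex reading is storey 17's zero reading (`rfl`). [cite: Balaban1988RG2Cluster, Lemma 1 (1.33) p.9 (degenerate instance)] -/
theorem zero_toReal : (ReadingAtomsC.zero : 𝔇.ReadingAtomsC Z t S).toReal = ReadingAtoms.zero := rfl

/-! ## §4  Algebraic faces: linearity in the history, history seen only on the tables, field locality, crude and located size -/

/-- Face: the zero history is read as `0`. [cite: Balaban1988RG2Cluster, Lemma 1 (1.33) p.9 (bookkeeping)] -/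
@[simp] theorem potentialC_zero_old (ξ : CPair P 𝔸) (Y : TDom P.d (L * domCount P M (k + 1))) (z : (𝔇.𝒦 Z t).Λ → ℂ) :
    R.potentialC 0 ξ Y z = 0 := by
  simp [potentialC]

/-- Face: the complex reading is `ℂ`-homogeneous in the history. [cite: Balaban1988RG2Cluster, Lemma 1 (1.33) p.9 (bookkeeping)] -/
theorem potentialC_smul_old (a : ℂ) (old : OlderTerms P 𝔸 M k) (ξ : CPair P 𝔸) (Y : TDom P.d (L * domCount P M (k + 1)))
    (z : (𝔇.𝒦 Z t).Λ → ℂ) : R.potentialC (a • old) ξ Y z = a * R.potentialC old ξ Y z := by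
  simp only [potentialC, Pi.smul_apply, smul_eq_mul, Finset.mul_sum]
  refine Finset.sum_congr rfl fun j _ => Finset.sum_congr rfl fun X _ => ?_
  rw [← integral_const_mul]
  exact integral_congr_ae (Eventually.of_forall fun s => by ring)

/-- **Face: the complex reading sees the history ONLY ON THE TABLES** — two histories agreeing on every table `sp j X` are read alike at every
`ξ ∈ W`, `z ∈ 𝔅c` ([I] §1 p. 263; (3.17)–(3.18)). [cite: Balaban1987RG1, §1 p.263 and (3.17)-(3.18) p.273] -/
theorem potentialC_congr_of_eqOn_tables {sp : (j : ℕ) → (domSys P M j).Dom → Set (CPair P 𝔸)} {W : Set (CPair P 𝔸)}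
    {𝔅c : Set ((𝔇.𝒦 Z t).Λ → ℂ)} (hmaps : R.MapsToTablesC sp W 𝔅c) {old old' : OlderTerms P 𝔸 M k}
    (h : ∀ (j : Fin (k + 1)) (X : (domSys P M j).Dom), EqOn (old j X) (old' j X) (sp j X)) {ξ : CPair P 𝔸} (hξ : ξ ∈ W)
    (Y : TDom P.d (L * domCount P M (k + 1))) {z : (𝔇.𝒦 Z t).Λ → ℂ} (hz : z ∈ 𝔅c) :
    R.potentialC old ξ Y z = R.potentialC old' ξ Y z := by
  refine Finset.sum_congr rfl fun j _ => Finset.sum_congr rfl fun X _ => integral_congr_ae (Eventually.of_forall fun s => ?_)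
  simp only [h j X (hmaps Y j X ξ hξ z hz s)]

/-- **Face: complex-field locality of the complex read potential**: if the configuration families of the domains `Y ∈ 𝐃` read the complex field
only in `S₀`, so does the complex read potential. [cite: Balaban1988RG2Cluster, (2.2)-(2.3) p.12 and (1.34) p.9] -/
theorem potentialC_local_of_localInC {S₀ : Set (𝔇.𝒦 Z t).Λ} (hloc : R.LocalInC S₀) (old : OlderTerms P 𝔸 M k) (ξ : CPair P 𝔸)
    {Y : TDom P.d (L * domCount P M (k + 1))} (hY : Y ∈ t.1) {z z' : (𝔇.𝒦 Z t).Λ → ℂ} (hzz' : ∀ b ∈ S₀, z b = z' b) :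
    R.potentialC old ξ Y z = R.potentialC old ξ Y z' := by
  refine Finset.sum_congr rfl fun j _ => Finset.sum_congr rfl fun X _ => integral_congr_ae (Eventually.of_forall fun s => ?_)
  simp only [hloc Y hY j X ξ z z' hzz' s]

/-- **Face: the crude (1.18)-size of the complex reading of a size-admissible history** (uniform masses; `Y`-free: the (1.18) bound of each older
term on its table, times the kernel bound and the mass, summed over the atoms — NOT print's (1.36)).
[cite: Balaban1987RG1, (1.18) p.263; Balaban1988RG2Cluster, (1.36) p.9 (the crude form only)] -/
theorem norm_potentialC_le_of_sizeAdm {sp : (j : ℕ) → (domSys P M j).Dom → Set (CPair P 𝔸)} {W : Set (CPair P 𝔸)}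
    {𝔅c : Set ((𝔇.𝒦 Z t).Λ → ℂ)} {C m E₀ r₁ : ℝ} (hC : 0 ≤ C) (hE₀ : 0 ≤ E₀) (hmaps : R.MapsToTablesC sp W 𝔅c) (hK : R.KernelBounded C)
    (hμ : R.FiniteMass m) {old : OlderTerms P 𝔸 M k} (hold : old ∈ SizeAdm sp E₀ r₁ k) {ξ : CPair P 𝔸} (hξ : ξ ∈ W)
    (Y : TDom P.d (L * domCount P M (k + 1))) {z : (𝔇.𝒦 Z t).Λ → ℂ} (hz : z ∈ 𝔅c) :
    ‖R.potentialC old ξ Y z‖ ≤ ∑ j : Fin (k + 1), ∑ X : (domSys P M j).Dom, C * (E₀ * Real.exp (-(r₁ * (domSys P M j).dj X))) * m := by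
  refine (norm_sum_le _ _).trans (Finset.sum_le_sum fun j _ => (norm_sum_le _ _).trans (Finset.sum_le_sum fun X _ => ?_))
  obtain ⟨-, hKb⟩ := hK Y j X
  obtain ⟨hfin, hmass⟩ := hμ Y j X
  haveI : IsFiniteMeasure (R.μ Y j X) := hfin
  have hc : 0 ≤ C * (E₀ * Real.exp (-(r₁ * (domSys P M j).dj X))) := mul_nonneg hC (mul_nonneg hE₀ (Real.exp_pos _).le)
  have hpt : ∀ s, ‖R.K Y j X s * old j X (R.cfgC Y j X ξ z s)‖ ≤ C * (E₀ * Real.exp (-(r₁ * (domSys P M j).dj X))) := fun s => by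
    rw [norm_mul]
    exact mul_le_mul (hKb s) (hold j X _ (hmaps Y j X ξ hξ z hz s)) (norm_nonneg _) hC
  calc ‖∫ s, R.K Y j X s * old j X (R.cfgC Y j X ξ z s) ∂(R.μ Y j X)‖
      ≤ C * (E₀ * Real.exp (-(r₁ * (domSys P M j).dj X))) * (R.μ Y j X).real univ :=
        norm_integral_le_of_norm_le_const (Eventually.of_forall hpt)
    _ ≤ C * (E₀ * Real.exp (-(r₁ * (domSys P M j).dj X))) * m := mul_le_mul_of_nonneg_left hmass hc

/-- **★ Face: the LOCATED crude (1.18)-size of the complex reading of a size-admissible history** (per-atom masses `m Y j X`; the record's `hOM`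
shape with the letter `M𝒪 := crudeBound C E₀ r₁ m`): `‖𝒪ᶜ_R(old, ξ; Y, z)‖ ≤ crudeBound C E₀ r₁ m Y` at every `ξ ∈ W`, `z ∈ 𝔅c`.
[cite: Balaban1987RG1, (1.18) p.263; Balaban1988RG2Cluster, (1.36) p.9 (the crude located form only) and Lemma 2 (1.41)-(1.42) p.11] -/
theorem norm_potentialC_le_of_sizeAdm_at {sp : (j : ℕ) → (domSys P M j).Dom → Set (CPair P 𝔸)} {W : Set (CPair P 𝔸)}
    {𝔅c : Set ((𝔇.𝒦 Z t).Λ → ℂ)} {C E₀ r₁ : ℝ} {m : TDom P.d (L * domCount P M (k + 1)) → (j : Fin (k + 1)) → (domSys P M j).Dom → ℝ}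
    (hC : 0 ≤ C) (hE₀ : 0 ≤ E₀) (hmaps : R.MapsToTablesC sp W 𝔅c) (hK : R.KernelBounded C) (hμ : R.FiniteMassAt m) {old : OlderTerms P 𝔸 M k}
    (hold : old ∈ SizeAdm sp E₀ r₁ k) {ξ : CPair P 𝔸} (hξ : ξ ∈ W) (Y : TDom P.d (L * domCount P M (k + 1))) {z : (𝔇.𝒦 Z t).Λ → ℂ}
    (hz : z ∈ 𝔅c) : ‖R.potentialC old ξ Y z‖ ≤ crudeBound C E₀ r₁ m Y := by
  refine (norm_sum_le _ _).trans (Finset.sum_le_sum fun j _ => (norm_sum_le _ _).trans (Finset.sum_le_sum fun X _ => ?_))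
  obtain ⟨-, hKb⟩ := hK Y j X
  obtain ⟨hfin, hmass⟩ := hμ Y j X
  haveI : IsFiniteMeasure (R.μ Y j X) := hfin
  have hc : 0 ≤ C * (E₀ * Real.exp (-(r₁ * (domSys P M j).dj X))) := mul_nonneg hC (mul_nonneg hE₀ (Real.exp_pos _).le)
  have hpt : ∀ s, ‖R.K Y j X s * old j X (R.cfgC Y j X ξ z s)‖ ≤ C * (E₀ * Real.exp (-(r₁ * (domSys P M j).dj X))) := fun s => by
    rw [norm_mul]
    exact mul_le_mul (hKb s) (hold j X _ (hmaps Y j X ξ hξ z hz s)) (norm_nonneg _) hC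
  calc ‖∫ s, R.K Y j X s * old j X (R.cfgC Y j X ξ z s) ∂(R.μ Y j X)‖
      ≤ C * (E₀ * Real.exp (-(r₁ * (domSys P M j).dj X))) * (R.μ Y j X).real univ :=
        norm_integral_le_of_norm_le_const (Eventually.of_forall hpt)
    _ ≤ C * (E₀ * Real.exp (-(r₁ * (domSys P M j).dj X))) * m Y j X := mul_le_mul_of_nonneg_left hmass hc

/-! ## §5  Analytic faces: holomorphy in the COMPLEX FIELD and in the configuration -/

section Analytic

variable [NormedRing 𝔸] [NormedAlgebra ℂ 𝔸] [TopologicalSpace S] [OpensMeasurableSpace S]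

/-- **★ FACE — HOLOMORPHY OF THE COMPLEX READ POTENTIAL IN THE COMPLEX FIELD, EVERY ADMISSIBLE HISTORY, EVERY `ξ ∈ W`** (the record's `hOd`
shape): on an open complex field set `𝔅c` on which the configuration families are analytic in the field and stay in the tables, for a history
bounded and analytic on the tables ([I] §1 p. 263), `z ↦ 𝒪ᶜ_R(old, ξ; Y, z)` is complex differentiable on `𝔅c` — by the dominated holomorphic
parametric-integral lemma applied to `K(s)·E^{(j)}(X; cfgC(ξ, z, s))` (bounded kernel × (1.18)-bounded analytic function of a configuration moving
analytically with the field inside the table), the parameter being the complex field ([I] p. 272 ll. 33–39: (3.13) «analytic in A»; [II] (1.34),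
Lemma 2 p. 11). [cite: Balaban1987RG1, §1 p.263, (3.10) and (3.13)-(3.14) p.272, (3.15)-(3.18) p.273; Balaban1988RG2Cluster, Lemma 1 (1.34) p.9, p.10 ll.30-31 and Lemma 2 (1.41)-(1.42) p.11] -/
theorem differentiableOn_potentialC_field_of_admHist {sp : (j : ℕ) → (domSys P M j).Dom → Set (CPair P 𝔸)} {W : Set (CPair P 𝔸)}
    {𝔅c : Set ((𝔇.𝒦 Z t).Λ → ℂ)} {C m E₀ r₁ : ℝ} (h𝔅c : IsOpen 𝔅c) (hmaps : R.MapsToTablesC sp W 𝔅c) (hhol : R.CfgFieldHoloOn W 𝔅c)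
    (hcont : R.CfgCContinuous) (hK : R.KernelBounded C) (hμ : R.FiniteMass m) {old : OlderTerms P 𝔸 M k} (hold : old ∈ AdmHist sp E₀ r₁ k)
    {ξ : CPair P 𝔸} (hξ : ξ ∈ W) (Y : TDom P.d (L * domCount P M (k + 1))) :
    DifferentiableOn ℂ (fun z : (𝔇.𝒦 Z t).Λ → ℂ => R.potentialC old ξ Y z) 𝔅c := by
  refine DifferentiableOn.fun_sum fun j _ => DifferentiableOn.fun_sum fun X _ => ?_
  obtain ⟨hKm, hKb⟩ := hK Y j X
  obtain ⟨hfin, -⟩ := hμ Y j X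
  haveI : IsFiniteMeasure (R.μ Y j X) := hfin
  refine Literature.Analysis.Complex.differentiableOn_integral_of_dominated (fun z hz => ?_) (Eventually.of_forall fun s => ?_)
    (fun z₀ hz₀ => ?_)
  · have hc : Continuous fun s : S => old j X (R.cfgC Y j X ξ z s) :=
      continuous_iff_continuousAt.2 fun s =>
        ((hold.2 j X) _ (hmaps Y j X ξ hξ z hz s)).continuousAt.comp (hcont Y j X ξ z).continuousAt
    exact hKm.aestronglyMeasurable.mul hc.aestronglyMeasurable
  · exact (differentiableOn_const _).mul fun z hz =>
      ((hold.2 j X) _ (hmaps Y j X ξ hξ z hz s)).differentiableAt.comp_differentiableWithinAt z (hhol Y j X ξ hξ s z hz)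
  · obtain ⟨ε, hε, hball⟩ := Metric.isOpen_iff.1 h𝔅c z₀ hz₀
    refine ⟨ε, hε, hball, fun _ => C * (E₀ * Real.exp (-(r₁ * (domSys P M j).dj X))), integrable_const _,
      Eventually.of_forall fun s z hz => ?_⟩
    rw [norm_mul]
    exact mul_le_mul (hKb s) (hold.1 j X _ (hmaps Y j X ξ hξ z (hball hz) s)) (norm_nonneg _) ((norm_nonneg _).trans (hKb s))

/-- **FACE — HOLOMORPHY OF THE COMPLEX READ POTENTIAL IN THE CONFIGURATION AT A COMPLEX FIELD, EVERY ADMISSIBLE HISTORY** (the record's `h𝒪d`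
shape at `z ∈ 𝔅c`): on an open window `W` on which the configuration families move analytically at the complex fields of `𝔅c` and stay in the
tables, `ξ ↦ 𝒪ᶜ_R(old, ξ; Y, z)` is complex differentiable on `W` — the same lemma, the parameter being `ξ`.
[cite: Balaban1987RG1, §1 p.263, (3.10) p.272 and (3.15)-(3.18) p.273; Balaban1988RG2Cluster, Lemma 2 (1.41) p.11 and (2.14) p.15 ll.19-20] -/
theorem differentiableOn_potentialC_config_of_admHist {sp : (j : ℕ) → (domSys P M j).Dom → Set (CPair P 𝔸)} {W : Set (CPair P 𝔸)}
    {𝔅c : Set ((𝔇.𝒦 Z t).Λ → ℂ)} {C m E₀ r₁ : ℝ} (hW : IsOpen W) (hmaps : R.MapsToTablesC sp W 𝔅c) (hhol : R.CfgCHoloOn W 𝔅c)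
    (hcont : R.CfgCContinuous) (hK : R.KernelBounded C) (hμ : R.FiniteMass m) {old : OlderTerms P 𝔸 M k} (hold : old ∈ AdmHist sp E₀ r₁ k)
    {z : (𝔇.𝒦 Z t).Λ → ℂ} (hz : z ∈ 𝔅c) (Y : TDom P.d (L * domCount P M (k + 1))) :
    DifferentiableOn ℂ (fun ξ : CPair P 𝔸 => R.potentialC old ξ Y z) W := by
  refine DifferentiableOn.fun_sum fun j _ => DifferentiableOn.fun_sum fun X _ => ?_
  obtain ⟨hKm, hKb⟩ := hK Y j X
  obtain ⟨hfin, -⟩ := hμ Y j X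
  haveI : IsFiniteMeasure (R.μ Y j X) := hfin
  refine Literature.Analysis.Complex.differentiableOn_integral_of_dominated (fun ξ hξ => ?_) (Eventually.of_forall fun s => ?_)
    (fun ξ₀ hξ₀ => ?_)
  · have hc : Continuous fun s : S => old j X (R.cfgC Y j X ξ z s) :=
      continuous_iff_continuousAt.2 fun s =>
        ((hold.2 j X) _ (hmaps Y j X ξ hξ z hz s)).continuousAt.comp (hcont Y j X ξ z).continuousAt
    exact hKm.aestronglyMeasurable.mul hc.aestronglyMeasurable
  · exact (differentiableOn_const _).mul fun ξ hξ =>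
      ((hold.2 j X) _ (hmaps Y j X ξ hξ z hz s)).differentiableAt.comp_differentiableWithinAt ξ (hhol Y j X z hz s ξ hξ)
  · obtain ⟨ε, hε, hball⟩ := Metric.isOpen_iff.1 hW ξ₀ hξ₀
    refine ⟨ε, hε, hball, fun _ => C * (E₀ * Real.exp (-(r₁ * (domSys P M j).dj X))), integrable_const _,
      Eventually.of_forall fun s ξ hξ => ?_⟩
    rw [norm_mul]
    exact mul_le_mul (hKb s) (hold.1 j X _ (hmaps Y j X ξ (hball hξ) z hz s)) (norm_nonneg _) ((norm_nonneg _).trans (hKb s))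

end Analytic

end ReadingAtomsC

/-! ## §6  The datum-level complex reading, its real slice, and the hypothesis schema on an opaque complex older-terms potential -/

variable {𝔇}

/-- **THE COMPLEX OLDER-TERMS POTENTIAL READ BY A FAMILY OF COMPLEX READINGS** (one per term slice, common parameter space `S`): storey 12b's
`ComplexOlder` given slice by slice by `ReadingAtomsC.potentialC` — the record's `Oc` for a read datum.
[cite: Balaban1988RG2Cluster, Lemma 1 (1.33)-(1.34) p.9 and Lemma 2 (1.41)-(1.42) p.11; Balaban1987RG1, (3.13)-(3.14) p.272] -/
def readOlderC {S : Type*} [MeasurableSpace S] (Rc : (Z : (domSys P M (k + 1)).Dom) → (t : TermLabel P M k L) → 𝔇.ReadingAtomsC Z t S) :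
    𝔇.ComplexOlder :=
  fun Z t old ξ Y z => (Rc Z t).potentialC old ξ Y z

/-- Face: the complex read potential at a slice (`rfl`). [cite: Balaban1988RG2Cluster, Lemma 2 (1.41) p.11 (bookkeeping)] -/
@[simp] theorem readOlderC_apply {S : Type*} [MeasurableSpace S]
    (Rc : (Z : (domSys P M (k + 1)).Dom) → (t : TermLabel P M k L) → 𝔇.ReadingAtomsC Z t S) (Z : (domSys P M (k + 1)).Dom) (t : TermLabel P M k L)
    (old : OlderTerms P 𝔸 M k) (ξ : CPair P 𝔸) (Y : TDom P.d (L * domCount P M (k + 1))) (z : (𝔇.𝒦 Z t).Λ → ℂ) :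
    𝔇.readOlderC Rc Z t old ξ Y z = (Rc Z t).potentialC old ξ Y z :=
  rfl

/-- **★ Face: THE REAL SLICE OF THE COMPLEX READ POTENTIAL IS STOREY 17's READ POTENTIAL OF THE REAL SLICES** (`rfl`): `realSliceOlder (readOlderC Rc)
= readOlder (fun Z t => (Rc Z t).toReal)` — so a producer defining the law's `𝒪 := realSliceOlder Oc` at `Oc := readOlderC Rc` has the record's
`h𝒪re` by `rfl` AND storey 17's ∕ module J15's real-slice laws for `readOlder (toReal ∘ Rc)` by name.
[cite: Balaban1988RG2Cluster, Lemma 1 (1.33)-(1.35) p.9 and Lemma 2 (1.41) p.11; Balaban1987RG1, (3.10) p.272] -/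
theorem realSliceOlder_readOlderC {S : Type*} [MeasurableSpace S]
    (Rc : (Z : (domSys P M (k + 1)).Dom) → (t : TermLabel P M k L) → 𝔇.ReadingAtomsC Z t S) :
    𝔇.realSliceOlder (𝔇.readOlderC Rc) = 𝔇.readOlder fun Z t => (Rc Z t).toReal :=
  rfl

/-- Face: the same pointwise — storey 17's read potential of the real slices at `A` is the complex read potential at `A ↪ ℂ` (`rfl`; the record's
`h𝒪re` for the read pair `(readOlder (toReal ∘ Rc), readOlderC Rc)`). [cite: Balaban1988RG2Cluster, Lemma 2 (1.41) p.11 (bookkeeping)] -/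
theorem readOlder_toReal_apply {S : Type*} [MeasurableSpace S]
    (Rc : (Z : (domSys P M (k + 1)).Dom) → (t : TermLabel P M k L) → 𝔇.ReadingAtomsC Z t S) (Z : (domSys P M (k + 1)).Dom) (t : TermLabel P M k L)
    (old : OlderTerms P 𝔸 M k) (ξ : CPair P 𝔸) (Y : TDom P.d (L * domCount P M (k + 1))) (A : (𝔇.𝒦 Z t).Λ → ℝ) :
    𝔇.readOlder (fun Z t => (Rc Z t).toReal) Z t old ξ Y A = 𝔇.readOlderC Rc Z t old ξ Y (ofRealVec A) :=
  rfl

/-- **HYPOTHESIS SCHEMA (located, one slice): the opaque complex older-terms potential `Oc` IS READ by the complex reading `R` on the admissible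
histories `Adm`, the configuration window `W` and the complex field set `𝔅c`** — the identity (1.33) ∕ (1.41) on the space (1.34) where print
states it. [cite: Balaban1988RG2Cluster, Lemma 1 (1.33)-(1.35) p.9 and Lemma 2 (1.41)-(1.42) p.11; Balaban1987RG1, §1 p.263 and (3.13)-(3.14) p.272] -/
def ReadsOnByC (Oc : 𝔇.ComplexOlder) (Z : (domSys P M (k + 1)).Dom) (t : TermLabel P M k L) {S : Type*} [MeasurableSpace S]
    (R : 𝔇.ReadingAtomsC Z t S) (Adm : Set (OlderTerms P 𝔸 M k)) (W : Set (CPair P 𝔸)) (𝔅c : Set ((𝔇.𝒦 Z t).Λ → ℂ)) : Prop :=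
  ∀ old ∈ Adm, ∀ ξ ∈ W, ∀ (Y : TDom P.d (L * domCount P M (k + 1))), ∀ z ∈ 𝔅c, Oc Z t old ξ Y z = R.potentialC old ξ Y z

/-- Face: the complex read potential is read by its readings, on any classes (`rfl`). [cite: Balaban1988RG2Cluster, Lemma 2 (1.41) p.11 (bookkeeping)] -/
theorem readsOnByC_readOlderC {S : Type*} [MeasurableSpace S]
    (Rc : (Z : (domSys P M (k + 1)).Dom) → (t : TermLabel P M k L) → 𝔇.ReadingAtomsC Z t S) (Z : (domSys P M (k + 1)).Dom) (t : TermLabel P M k L)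
    (Adm : Set (OlderTerms P 𝔸 M k)) (W : Set (CPair P 𝔸)) (𝔅c : Set ((𝔇.𝒦 Z t).Λ → ℂ)) :
    𝔇.ReadsOnByC (𝔇.readOlderC Rc) Z t (Rc Z t) Adm W 𝔅c :=
  fun _ _ _ _ _ _ _ => rfl

/-- Face: a located complex reading restricts to smaller classes. [cite: Balaban1988RG2Cluster, Lemma 2 (1.41) p.11 (bookkeeping)] -/
theorem ReadsOnByC.mono {Oc : 𝔇.ComplexOlder} {Z : (domSys P M (k + 1)).Dom} {t : TermLabel P M k L} {S : Type*} [MeasurableSpace S]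
    {R : 𝔇.ReadingAtomsC Z t S} {Adm Adm' : Set (OlderTerms P 𝔸 M k)} {W W' : Set (CPair P 𝔸)} {𝔅c 𝔅c' : Set ((𝔇.𝒦 Z t).Λ → ℂ)}
    (h : 𝔇.ReadsOnByC Oc Z t R Adm W 𝔅c) (hAdm : Adm' ⊆ Adm) (hW : W' ⊆ W) (h𝔅 : 𝔅c' ⊆ 𝔅c) : 𝔇.ReadsOnByC Oc Z t R Adm' W' 𝔅c' :=
  fun old hold ξ hξ Y z hz => h old (hAdm hold) ξ (hW hξ) Y z (h𝔅 hz)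

/-- **Face: a located complex reading of `Oc` gives storey 17's located reading of its REAL SLICE `realSliceOlder Oc` by the real slice `R.toReal`**,
on any real field set whose complexification lies in `𝔅c` — whence module J15's four real-slice laws by name.
[cite: Balaban1988RG2Cluster, Lemma 1 (1.33)-(1.35) p.9 and Lemma 2 (1.41) p.11; Balaban1987RG1, (3.10) p.272] -/
theorem ReadsOnByC.realSlice {Oc : 𝔇.ComplexOlder} {Z : (domSys P M (k + 1)).Dom} {t : TermLabel P M k L} {S : Type*} [MeasurableSpace S]
    {R : 𝔇.ReadingAtomsC Z t S} {Adm : Set (OlderTerms P 𝔸 M k)} {W : Set (CPair P 𝔸)} {𝔅c : Set ((𝔇.𝒦 Z t).Λ → ℂ)}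
    {𝔅 : Set ((𝔇.𝒦 Z t).Λ → ℝ)} (h : 𝔇.ReadsOnByC Oc Z t R Adm W 𝔅c) (h𝔅 : ∀ A ∈ 𝔅, ofRealVec A ∈ 𝔅c) :
    𝔇.ReadsOnBy (𝔇.realSliceOlder Oc) Z t R.toReal Adm W 𝔅 :=
  fun old hold ξ hξ Y A hA => h old hold ξ hξ Y (ofRealVec A) (h𝔅 A hA)

/-! ## §7  Transfer faces: the complex-side located inputs of an opaque `Oc` read on the admissible class -/

namespace ReadsOnByC

variable [NormedRing 𝔸] [NormedAlgebra ℂ 𝔸]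
variable {Oc : 𝔇.ComplexOlder} {Z : (domSys P M (k + 1)).Dom} {t : TermLabel P M k L} {S : Type*} [MeasurableSpace S]
  {R : 𝔇.ReadingAtomsC Z t S} {sp : (j : ℕ) → (domSys P M j).Dom → Set (CPair P 𝔸)} {W : Set (CPair P 𝔸)}
  {𝔅c : Set ((𝔇.𝒦 Z t).Λ → ℂ)} {E₀ r₁ : ℝ}

/-- **★ Transfer: the SUP BOUND of a read `Oc` on the complex field set, every admissible history, every `ξ ∈ W`** (the record's `hOM` with the
`Y`-free crude constant at uniform masses). [cite: Balaban1987RG1, (1.18) p.263; Balaban1988RG2Cluster, (1.36) p.9 (crude form only) and Lemma 2 (1.41)-(1.42) p.11] -/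
theorem norm_le {C m : ℝ} (h : 𝔇.ReadsOnByC Oc Z t R (AdmHist sp E₀ r₁ k) W 𝔅c) (hC : 0 ≤ C) (hE₀ : 0 ≤ E₀) (hmaps : R.MapsToTablesC sp W 𝔅c)
    (hK : R.KernelBounded C) (hμ : R.FiniteMass m) {old : OlderTerms P 𝔸 M k} (hold : old ∈ AdmHist sp E₀ r₁ k) {ξ : CPair P 𝔸} (hξ : ξ ∈ W)
    (Y : TDom P.d (L * domCount P M (k + 1))) {z : (𝔇.𝒦 Z t).Λ → ℂ} (hz : z ∈ 𝔅c) :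
    ‖Oc Z t old ξ Y z‖ ≤ ∑ j : Fin (k + 1), ∑ X : (domSys P M j).Dom, C * (E₀ * Real.exp (-(r₁ * (domSys P M j).dj X))) * m := by
  rw [h old hold ξ hξ Y z hz]
  exact R.norm_potentialC_le_of_sizeAdm hC hE₀ hmaps hK hμ hold.1 hξ Y hz

/-- **★ Transfer: the LOCATED SUP BOUND of a read `Oc` on the complex field set, every admissible history, every `ξ ∈ W`** (the record's `hOM`
VERBATIM at `𝔅c := ball 0 R_A` with the letter `M𝒪 := crudeBound C E₀ r₁ m`, its sign `hM𝒪` by `crudeBound_nonneg`).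
[cite: Balaban1987RG1, (1.18) p.263; Balaban1988RG2Cluster, (1.36) p.9 (crude located form only) and Lemma 2 (1.41)-(1.42) p.11] -/
theorem norm_le_at {C : ℝ} {m : TDom P.d (L * domCount P M (k + 1)) → (j : Fin (k + 1)) → (domSys P M j).Dom → ℝ}
    (h : 𝔇.ReadsOnByC Oc Z t R (AdmHist sp E₀ r₁ k) W 𝔅c) (hC : 0 ≤ C) (hE₀ : 0 ≤ E₀) (hmaps : R.MapsToTablesC sp W 𝔅c) (hK : R.KernelBounded C)
    (hμ : R.FiniteMassAt m) {old : OlderTerms P 𝔸 M k} (hold : old ∈ AdmHist sp E₀ r₁ k) {ξ : CPair P 𝔸} (hξ : ξ ∈ W)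
    (Y : TDom P.d (L * domCount P M (k + 1))) {z : (𝔇.𝒦 Z t).Λ → ℂ} (hz : z ∈ 𝔅c) :
    ‖Oc Z t old ξ Y z‖ ≤ crudeBound C E₀ r₁ m Y := by
  rw [h old hold ξ hξ Y z hz]
  exact R.norm_potentialC_le_of_sizeAdm_at hC hE₀ hmaps hK hμ hold.1 hξ Y hz

variable [TopologicalSpace S] [OpensMeasurableSpace S]

/-- **★ Transfer: ANALYTICITY of a read `Oc` IN THE COMPLEX FIELD on the open field set, every admissible history, every `ξ ∈ W`** (the record's
`hOd` VERBATIM at `𝔅c := ball 0 R_A`). [cite: Balaban1987RG1, §1 p.263 and (3.13)-(3.14) p.272; Balaban1988RG2Cluster, Lemma 1 (1.34) p.9 and Lemma 2 (1.41)-(1.42) p.11] -/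
theorem differentiableOn_field {C m : ℝ} (h : 𝔇.ReadsOnByC Oc Z t R (AdmHist sp E₀ r₁ k) W 𝔅c) (h𝔅c : IsOpen 𝔅c)
    (hmaps : R.MapsToTablesC sp W 𝔅c) (hhol : R.CfgFieldHoloOn W 𝔅c) (hcont : R.CfgCContinuous) (hK : R.KernelBounded C) (hμ : R.FiniteMass m)
    {old : OlderTerms P 𝔸 M k} (hold : old ∈ AdmHist sp E₀ r₁ k) {ξ : CPair P 𝔸} (hξ : ξ ∈ W) (Y : TDom P.d (L * domCount P M (k + 1))) :
    DifferentiableOn ℂ (Oc Z t old ξ Y) 𝔅c :=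
  (R.differentiableOn_potentialC_field_of_admHist h𝔅c hmaps hhol hcont hK hμ hold hξ Y).congr fun z hz => h old hold ξ hξ Y z hz

/-- Transfer: holomorphy in the configuration of a read `Oc` at a complex field of `𝔅c`, every admissible history (the record's `h𝒪d` shape at
complex fields). [cite: Balaban1987RG1, §1 p.263 and (3.10) p.272; Balaban1988RG2Cluster, Lemma 2 (1.41) p.11 and (2.14) p.15 ll.19-20] -/
theorem differentiableOn_config {C m : ℝ} (h : 𝔇.ReadsOnByC Oc Z t R (AdmHist sp E₀ r₁ k) W 𝔅c) (hW : IsOpen W)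
    (hmaps : R.MapsToTablesC sp W 𝔅c) (hhol : R.CfgCHoloOn W 𝔅c) (hcont : R.CfgCContinuous) (hK : R.KernelBounded C) (hμ : R.FiniteMass m)
    {old : OlderTerms P 𝔸 M k} (hold : old ∈ AdmHist sp E₀ r₁ k) {z : (𝔇.𝒦 Z t).Λ → ℂ} (hz : z ∈ 𝔅c)
    (Y : TDom P.d (L * domCount P M (k + 1))) :
    DifferentiableOn ℂ (fun ξ : CPair P 𝔸 => Oc Z t old ξ Y z) W :=
  (R.differentiableOn_potentialC_config_of_admHist hW hmaps hhol hcont hK hμ hold hz Y).congr fun ξ hξ => h old hold ξ hξ Y z hz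

end ReadsOnByC

end TermDatum214

end W1

end Literature.MathematicalPhysics.QuantumFieldTheory.Balaban1983to89.Node00

end
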